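import Mathlib.FieldTheory.Finite.Basic
import Mathlib.GroupTheory.Torsion
import Mathlib.RingTheory.Int.Basic
import HarnessLib

/-!
# `E[p] = ℤQ₀ ⊕ ℤP₁` for a line `ℤP₁ = K₁ ∩ E[p]` of prime order: the quotient `E[p]/C[p]` has no
# fixed vector under an endomorphism moving it, and the scalars of such an endomorphism
# (row T-T3B, file F5a; generic finite-group algebra, team n1011, seat p12 GEN 8)

HONEST FRAMING (cell `b2b-bsdres`, run/shared/lean/b2b/bsd-rank1-residual/, verbatim in every
file): the goal of the cell is to DELETE the COMBINATION-SHAPED residual classes of the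
Birch–Swinnerton-Dyer formula for ALL analytic-rank `≤ 1` elliptic curves over `ℚ` — "full BSD
formula for every rank `≤ 1` curve in class `C`" assembled STRICTLY from published theorems — so
that the rank-`≤ 1` remainder becomes exactly the CONSTRUCTION-SHAPED classes, which are TYPED
(missing-input `Prop`s), NOT attempted. This is not "finishing BSD". Team n1011 (N10/N11; row
T-T3B = the `v = p` local tower kernel at level `0` for additive potentially good ordinary
reduction, skeleton `cells/n1011/skel/T-T3B.md`): research routes on CONSTRUCTION-SHAPED classes;
prove what is provable now; no claim beyond stated classes; census output = EVIDENCE, never a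
Literature fact; RESIDUAL-MAP marks UNCHANGED; nothing is booked by this file. TOOL THEOREMS ONLY:
no definition, no named fact, nothing cited enters as a hypothesis.

## What (pure algebra of an abelian group `A` with `#A[p] = p²`; no Galois theory, no curve)

Data: a prime `p`, a subgroup `K₁ ≤ A` ("the kernel of reduction of a good model"), `P₁ ∈ K₁` of
order `p` with `K₁[p] = ℤP₁` ("`C[p]`, the `p`-torsion of the canonical line is cyclic of order `p`",
the tree's `exists_generator_torsionBy_ker_goodReductionHom`), `#A[p] = p²` (`card_torsionBy_eq_sq`),
and an additive endomorphism `σ` of `A` preserving `K₁` ("an element of the local Galois group").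

* `exists_eq_nsmul_add_nsmul` — for `Q₀ ∈ A[p] ∖ K₁`: every `Q ∈ A[p]` is `j • Q₀ + i • P₁` with
  `j, i < p` (counting: `(j, i) ↦ jQ₀ + iP₁` is injective on `Fin p × Fin p`, and `#A[p] = p²`).
* `mem_of_sub_mem_of_moves` — **the quotient `A[p]/K₁[p]` has no `σ`-fixed vector when `σ` moves
  it**: if `σP − P ∉ K₁` for some `P ∈ A[p]`, then every `t ∈ A[p]` with `σt − t ∈ K₁` lies in `K₁`
  (the input `hnp` of `ResKernelPrimary.exists_kerValued_cocycle_of_pow_smul_eq_zero`, row file F1: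
  "`D[p]^N = 0`").
* `exists_lineScalar_quotScalar` — the scalars: `σ = a` on `K₁[p]`, `σ ≡ c'` on `A[p]` modulo `ℤP₁`,
  with `p ∤ a`, `c' ≢ 1`, `a ≢ c'a (mod p)` when `σ` is injective and moves `A[p]/K₁[p]` (the
  inputs `h1`/`h2` of the tree's Weil scalar lemma `localPoints_exists_isPrimitiveRoot_smul_eq_pow`,
  whose output `σζ = ζ^{c'a}` then differs from the line character `a`: the hypothesis `hχ` of
  `PrimeOrderLine.exists_finset_cocycle_reps`, row file F3).

References: [GreenbergLNM1716] R. Greenberg, LNM 1716 (1999), §2 p. 70 (`φψ = χ` on the ordinary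
filtration), §3 Lemma 3.4 (p. 89); [SilvermanAEC2009] J. H. Silverman, *AEC*, III.6.4(b), III.8.1.
-/

universe u

namespace Summit.BirchSwinnertonDyer.Rank1Residual.Iwasawa

namespace PrimeTorsionLine

variable {A : Type u} [AddCommGroup A] {p : ℕ} [hp : Fact p.Prime]

/-! ## §0 Bookkeeping on elements of order `p` -/

/-- An integer multiple of an element of order `p` is a natural multiple (reduce mod `p`). [folklore] -/
theorem exists_zsmul_eq_nsmul {P₁ : A} (hP₁ : p • P₁ = 0) (k : ℤ) : ∃ d : ℕ, k • P₁ = d • P₁ := by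
  refine ⟨(k % p).toNat, ?_⟩
  have hnn : 0 ≤ k % p := Int.emod_nonneg _ (by exact_mod_cast hp.out.ne_zero)
  have hk : k = p * (k / p) + k % p := (Int.mul_ediv_add_emod k p).symm
  conv_lhs => rw [hk]
  rw [add_smul, mul_comm, mul_smul, natCast_zsmul, hP₁, smul_zero, zero_add, ← natCast_zsmul,
    Int.toNat_of_nonneg hnn]

/-- A `p`-torsion element some multiple `j • R`, `0 < j < p`, of which lies in a subgroup lies in the
subgroup (invert `j` mod `p`). [folklore] -/
theorem mem_of_nsmul_mem (K₁ : AddSubgroup A) {R : A} (hR : p • R = 0) {j : ℕ} (hj0 : j ≠ 0)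
    (hjp : j < p) (hjR : j • R ∈ K₁) : R ∈ K₁ := by
  have hcop : IsCoprime (j : ℤ) (p : ℤ) :=
    Nat.isCoprime_iff_coprime.mpr (Nat.coprime_of_lt_prime hj0 hjp hp.out).symm
  obtain ⟨α, β, hαβ⟩ := hcop
  have h : R = α • (j • R) + β • (p • R) := by
    rw [← natCast_zsmul R j, ← natCast_zsmul R p, smul_smul, smul_smul, ← add_smul, hαβ, one_smul]
  rw [h, hR, smul_zero, add_zero]
  exact K₁.zsmul_mem hjR α

/-- Integer form: a `p`-torsion element with `k • R ∈ K₁`, `p ∤ k`, lies in `K₁`. [folklore] -/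
theorem mem_of_zsmul_mem (K₁ : AddSubgroup A) {R : A} (hR : p • R = 0) {k : ℤ} (hk : ¬ (p : ℤ) ∣ k)
    (hkR : k • R ∈ K₁) : R ∈ K₁ := by
  have hcop : IsCoprime k (p : ℤ) :=
    (Int.isCoprime_iff_gcd_eq_one.mpr (by
      have hdvd' : Int.gcd k p ∣ p := by exact_mod_cast Int.gcd_dvd_right k p
      rcases (Nat.dvd_prime hp.out).mp hdvd' with h1 | h2
      · exact h1
      · exfalso; exact hk (by rw [← h2]; exact Int.gcd_dvd_left _ _)))
  obtain ⟨α, β, hαβ⟩ := hcop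
  have h : R = α • (k • R) + β • (p • R) := by
    rw [← natCast_zsmul R p, smul_smul, smul_smul, ← add_smul, hαβ, one_smul]
  rw [h, hR, smul_zero, add_zero]
  exact K₁.zsmul_mem hkR α

/-! ## §1 The decomposition `A[p] = ℤQ₀ + ℤP₁` -/

/-- **`A[p] = {j • Q₀ + i • P₁ : j, i < p}`** when `#A[p] = p²`, `P₁ ∈ K₁` has order `p` and
`Q₀ ∈ A[p] ∖ K₁`: the map `(j, i) ↦ jQ₀ + iP₁` on `Fin p × Fin p` is injective (a relation with
`j ≠ j'` would put `Q₀` in `K₁` by inverting `j − j'` mod `p`; then `(i − i')P₁ = 0` forces `i = i'`),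
hence onto `A[p]` by counting. (`E[p] ≅ (ℤ/p)²`, Silverman *AEC* III.6.4(b).)
[cite: SilvermanAEC2009, Cor. III.6.4(b)] -/
theorem exists_eq_nsmul_add_nsmul (K₁ : AddSubgroup A) {P₁ : A} (hP₁K : P₁ ∈ K₁)
    (hP₁ord : addOrderOf P₁ = p) (hcard : Nat.card {Q : A // p • Q = 0} = p ^ 2)
    {Q₀ : A} (hQ₀ : p • Q₀ = 0) (hQ₀K : Q₀ ∉ K₁) {Q : A} (hQ : p • Q = 0) :
    ∃ j i : ℕ, j < p ∧ i < p ∧ Q = j • Q₀ + i • P₁ := by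
  have hP₁p : p • P₁ = 0 := by rw [← hP₁ord]; exact addOrderOf_nsmul_eq_zero P₁
  haveI : Finite {Q : A // p • Q = 0} := Nat.finite_of_card_ne_zero (by
    rw [hcard]; exact pow_ne_zero 2 hp.out.ne_zero)
  letI : Fintype {Q : A // p • Q = 0} := Fintype.ofFinite _
  let f : Fin p × Fin p → {Q : A // p • Q = 0} := fun ji ↦
    ⟨(ji.1 : ℕ) • Q₀ + (ji.2 : ℕ) • P₁, by
      rw [smul_add, smul_comm, hQ₀, smul_zero, zero_add, smul_comm, hP₁p, smul_zero]⟩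
  have hf : Function.Injective f := by
    rintro ⟨j, i⟩ ⟨j', i'⟩ hji
    have h : (j : ℕ) • Q₀ + (i : ℕ) • P₁ = (j' : ℕ) • Q₀ + (i' : ℕ) • P₁ := congrArg Subtype.val hji
    -- `(j - j') • Q₀ = (i' - i) • P₁`
    have h' : (((j : ℕ) : ℤ) - ((j' : ℕ) : ℤ)) • Q₀ = (((i' : ℕ) : ℤ) - ((i : ℕ) : ℤ)) • P₁ := by
      rw [sub_smul, sub_smul, natCast_zsmul, natCast_zsmul, natCast_zsmul, natCast_zsmul]
      rw [sub_eq_sub_iff_add_eq_add, h]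
      abel
    by_cases hj : j = j'
    · subst hj
      rw [sub_self, zero_smul] at h'
      -- `(i' - i) • P₁ = 0` with `|i' - i| < p`
      have hdvd : (p : ℤ) ∣ ((i' : ℕ) : ℤ) - ((i : ℕ) : ℤ) := by
        have h0 : (((i' : ℕ) : ℤ) - ((i : ℕ) : ℤ)) • P₁ = 0 := h'.symm
        have := (addOrderOf_dvd_iff_zsmul_eq_zero).mpr h0
        rwa [hP₁ord] at this
      have hii : ((i' : ℕ) : ℤ) - ((i : ℕ) : ℤ) = 0 := by
        refine Int.eq_zero_of_dvd_of_natAbs_lt_natAbs hdvd ?_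
        rw [Int.natAbs_natCast]
        have h1 := i.2; have h2 := i'.2
        omega
      have : (i : ℕ) = i' := by omega
      exact Prod.ext rfl (Fin.ext this)
    · exfalso
      apply hQ₀K
      refine mem_of_zsmul_mem K₁ hQ₀ (k := ((j : ℕ) : ℤ) - ((j' : ℕ) : ℤ)) (fun hdvd ↦ ?_) ?_
      · have h0 : ((j : ℕ) : ℤ) - ((j' : ℕ) : ℤ) = 0 := by
          refine Int.eq_zero_of_dvd_of_natAbs_lt_natAbs hdvd ?_
          rw [Int.natAbs_natCast]
          have h1 := j.2; have h2 := j'.2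
          omega
        exact hj (Fin.ext (by omega))
      · rw [h']
        exact K₁.zsmul_mem hP₁K _
  have hbij : Function.Bijective f := (Fintype.bijective_iff_injective_and_card f).mpr
    ⟨hf, by rw [Fintype.card_prod, Fintype.card_fin, Fintype.card_eq_nat_card, hcard, sq]⟩
  obtain ⟨⟨j, i⟩, hji⟩ := hbij.2 ⟨Q, hQ⟩
  exact ⟨j, i, j.2, i.2, (congrArg Subtype.val hji).symm⟩

/-! ## §2 No fixed vector in `A[p]/K₁[p]` under an endomorphism moving it -/

/-- **If `σ` moves `A[p]/K₁[p]`, it fixes no non-zero class**: for an additive endomorphism `σ`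
preserving `K₁`, with `σP − P ∉ K₁` for some `P ∈ A[p]`, every `t ∈ A[p]` with `σt − t ∈ K₁` lies
in `K₁`. (Write `t = jP + iP₁`; then `σt − t ≡ j(σP − P) (mod K₁)`, and `j(σP − P) ∈ K₁` with
`0 < j < p` would put `σP − P` in `K₁`.) For the twisted ordinary line of an additive potentially
good ordinary curve this is `D[p]^N = 0` for the RAMIFIED quotient character — the input `hnp` of
`ResKernelPrimary.exists_kerValued_cocycle_of_pow_smul_eq_zero`.
[cite: GreenbergLNM1716, §3 Lemma 3.4 (p. 89)] -/
theorem mem_of_sub_mem_of_moves (K₁ : AddSubgroup A) {P₁ : A} (hP₁K : P₁ ∈ K₁)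
    (hP₁ord : addOrderOf P₁ = p) (hcard : Nat.card {Q : A // p • Q = 0} = p ^ 2)
    (σ : A →+ A) (hσK : ∀ P ∈ K₁, σ P ∈ K₁)
    (hmove : ∃ P : A, p • P = 0 ∧ σ P - P ∉ K₁)
    {t : A} (ht : p • t = 0) (hσt : σ t - t ∈ K₁) : t ∈ K₁ := by
  obtain ⟨P, hP, hPmove⟩ := hmove
  have hPK : P ∉ K₁ := fun h ↦ hPmove (K₁.sub_mem (hσK P h) h)
  obtain ⟨j, i, hj, -, rfl⟩ := exists_eq_nsmul_add_nsmul K₁ hP₁K hP₁ord hcard hP hPK ht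
  -- `σt − t = j (σP − P) + i (σP₁ − P₁)`
  have hdec : σ (j • P + i • P₁) - (j • P + i • P₁) = j • (σ P - P) + i • (σ P₁ - P₁) := by
    rw [map_add, map_nsmul, map_nsmul, smul_sub, smul_sub]; abel
  rw [hdec] at hσt
  have hjP : j • (σ P - P) ∈ K₁ := by
    have h2 : i • (σ P₁ - P₁) ∈ K₁ := K₁.nsmul_mem (K₁.sub_mem (hσK P₁ hP₁K) hP₁K) i
    have := K₁.sub_mem hσt h2
    rwa [add_sub_cancel_right] at this
  by_cases hj0 : j = 0
  · subst hj0
    rw [zero_smul, zero_add]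
    exact K₁.nsmul_mem hP₁K i
  · exfalso
    refine hPmove (mem_of_nsmul_mem K₁ ?_ hj0 hj hjP)
    rw [smul_sub, ← map_nsmul, hP, map_zero, sub_zero]

/-! ## §3 The scalars of `σ` on the line and on the quotient -/

/-- **Line scalar and quotient scalar.** With the data above and `σ` injective moving `A[p]/K₁[p]`:
there are `a c' : ℕ` with `σQ = a • Q` on `K₁[p]`, `σQ − c' • Q ∈ ℕP₁` on `A[p]`, and `p ∤ a`,
`c' ≢ 1 (mod p)`, `a ≢ c'·a (mod p)`. These are the hypotheses `h1`, `h2` of the tree's Weil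
scalar lemma `localPoints_exists_isPrimitiveRoot_smul_eq_pow` (which returns `σζ = ζ^{c'a}` on a
primitive `p`-th root of unity: `det ρ̄ = ω`), and `a ≢ c'a` is then the hypothesis `hχ` of
`PrimeOrderLine.exists_finset_cocycle_reps` (row file F3): the character of `C[p]` is not `ω`.
[cite: GreenbergLNM1716, §2 p. 70] [cite: SilvermanAEC2009, Prop. III.8.1] -/
theorem exists_lineScalar_quotScalar (K₁ : AddSubgroup A) {P₁ : A} (hP₁K : P₁ ∈ K₁)
    (hP₁ord : addOrderOf P₁ = p) (hK : ∀ P ∈ K₁, p • P = 0 → ∃ c : ℕ, P = c • P₁)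
    (hcard : Nat.card {Q : A // p • Q = 0} = p ^ 2)
    (σ : A →+ A) (hσinj : Function.Injective σ) (hσK : ∀ P ∈ K₁, σ P ∈ K₁)
    (hmove : ∃ P : A, p • P = 0 ∧ σ P - P ∉ K₁) :
    ∃ a c' : ℕ, (∀ Q ∈ K₁, p • Q = 0 → σ Q = a • Q) ∧
      (∀ Q : A, p • Q = 0 → ∃ d : ℕ, σ Q - c' • Q = d • P₁) ∧
      ¬ p ∣ a ∧ ¬ c' ≡ 1 [MOD p] ∧ ¬ a ≡ c' * a [MOD p] := by
  have hP₁p : p • P₁ = 0 := by rw [← hP₁ord]; exact addOrderOf_nsmul_eq_zero P₁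
  obtain ⟨P, hP, hPmove⟩ := hmove
  have hPK : P ∉ K₁ := fun h ↦ hPmove (K₁.sub_mem (hσK P h) h)
  -- the line scalar `a`
  obtain ⟨a, ha⟩ := hK (σ P₁) (hσK P₁ hP₁K) (by rw [← map_nsmul, hP₁p, map_zero])
  have hline : ∀ Q ∈ K₁, p • Q = 0 → σ Q = a • Q := by
    intro Q hQK hQp
    obtain ⟨c, rfl⟩ := hK Q hQK hQp
    rw [map_nsmul, ha, smul_comm]
  -- the quotient scalar `c'`: `σP = c' P + i₀ P₁`
  have hσPp : p • σ P = 0 := by rw [← map_nsmul, hP, map_zero]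
  obtain ⟨c', i₀, hc', -, hσP⟩ := exists_eq_nsmul_add_nsmul K₁ hP₁K hP₁ord hcard hP hPK hσPp
  have hquot : ∀ Q : A, p • Q = 0 → ∃ d : ℕ, σ Q - c' • Q = d • P₁ := by
    intro Q hQ
    obtain ⟨j, i, -, -, rfl⟩ := exists_eq_nsmul_add_nsmul K₁ hP₁K hP₁ord hcard hP hPK hQ
    -- `σQ − c'Q = (j i₀ + i a − c' i) • P₁` as an integer multiple
    have h : σ (j • P + i • P₁) - c' • (j • P + i • P₁) =
        ((j * i₀ : ℕ) + (i * a : ℕ) - (c' * i : ℕ) : ℤ) • P₁ := by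
      rw [map_add, map_nsmul, map_nsmul, hσP, ha]
      push_cast
      rw [sub_smul, add_smul, mul_smul, mul_smul, mul_smul, natCast_zsmul, natCast_zsmul,
        natCast_zsmul, natCast_zsmul, natCast_zsmul, natCast_zsmul]
      rw [smul_add, smul_add, smul_comm c' j P, smul_comm c' i P₁]
      abel
    obtain ⟨d, hd⟩ := exists_zsmul_eq_nsmul hP₁p ((j * i₀ : ℕ) + (i * a : ℕ) - (c' * i : ℕ) : ℤ)
    exact ⟨d, h.trans hd⟩
  have hpa : ¬ p ∣ a := by
    -- `p ∣ a` would give `σP₁ = 0`, contradicting injectivity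
    rintro ⟨q, rfl⟩
    have h0 : σ P₁ = 0 := by rw [ha, mul_comm, mul_smul, hP₁p, smul_zero]
    have hP₁0 : P₁ = 0 := hσinj (by rw [h0, map_zero])
    have : addOrderOf P₁ = 1 := by rw [hP₁0, addOrderOf_zero]
    rw [hP₁ord] at this
    exact hp.out.one_lt.ne' this
  have hc1 : ¬ c' ≡ 1 [MOD p] := by
    -- `c' ≡ 1` would give `σP − P = i₀ P₁ ∈ K₁`
    intro hc1
    apply hPmove
    have h : σ P - P = (σ P - c' • P) + (((c' : ℕ) : ℤ) - 1) • P := by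
      rw [sub_smul, natCast_zsmul, one_smul]; abel
    have hdvd : (p : ℤ) ∣ ((c' : ℕ) : ℤ) - 1 := by
      have := (Nat.modEq_iff_dvd.mp hc1.symm)
      simpa using this
    obtain ⟨q, hq⟩ := hdvd
    rw [h, hq, mul_comm, mul_smul, natCast_zsmul, hP, smul_zero, add_zero, hσP, add_sub_cancel_left]
    exact K₁.nsmul_mem hP₁K i₀
  refine ⟨a, c', hline, hquot, hpa, hc1, fun hac ↦ ?_⟩
  -- `a ≡ c' a` with `p ∤ a` forces `c' ≡ 1`
  have h1 : a * 1 ≡ a * c' [MOD p] := by rw [mul_one, mul_comm]; exact hac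
  have hcop : Nat.Coprime a p := ((Nat.Prime.coprime_iff_not_dvd hp.out).mpr hpa).symm
  exact hc1 (Nat.ModEq.cancel_left_of_coprime (by rwa [Nat.coprime_comm] at hcop) h1).symm

end PrimeTorsionLine

end Summit.BirchSwinnertonDyer.Rank1Residual.Iwasawa
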